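import Mathlib.Algebra.Polynomial.Derivative
import Mathlib.Analysis.Complex.Basic
import HarnessLib

/-!
# Kernel-checkable certificates for complex multiplication of a Weierstrass `℘`-function

Topic `NumberTheory/EllipticCurves`; computational layer below the CM-period leaf
`Literature.NumberTheory.EllipticCurves.exists_isCMPeriod_of_j_mem_maximalCMJInvariants` (Coates–Wiles 1977, §1 p. 225,
"`L = Ω𝓞`") of `Literature/…/ComplexMultiplicationCoatesWiles.lean`, which
`Literature/…/ComplexMultiplicationSingularModuli.lean` proved equivalent to the table of
singular moduli `j(𝓞_K)` of the nine imaginary quadratic fields of class number one (Cox,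
*Primes of the form x² + ny²*, §12.C (12.20)).

The seven non-elementary rows of that table (`d = −7, −8, −11, −19, −43, −67, −163`) are
established in this library by exhibiting, for a lattice `Λ` with prescribed invariants
`g₂ = A`, `g₃ = B` (integers with `1728A³/(A³ − 27B²) = j(𝓞_K)`), the **complex multiplication
`℘(αz) = R(℘(z))`, `R = P/Q`, by a generator `α` of `𝓞_K`** as an explicit rational function
with coefficients in `ℤ[α]` (classically: Abel 1828 and Eisenstein for `ℤ[i]`; the general
"transformation theory" of `℘`, Weber, *Lehrbuch der Algebra* III, §§ 114–115; in modern terms the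
`x`-coordinate map of the endomorphism `α` of the CM elliptic curve `y² = 4x³ − Ax − B`,
Silverman, *Advanced Topics*, II.2 and Prop. II.1.1).  Analytically (file
`LatticeEndomorphism.lean`) such an `R` forces `αΛ ⊆ Λ` as soon as `R ∘ ℘` satisfies the
Weierstrass differential equations scaled by `α`, which amounts to two polynomial identities

* `(H1)` `f · (P'Q − PQ')² = α² · (4P³ − A·P·Q² − B·Q³) · Q`, `f = 4X³ − AX − B`
  (i.e. `f(x) R'(x)² = α² f(R(x))`: `u = R(℘)` has `u'² = α² f(u)`), and
* `(H2)` `2[(P''Q − PQ'')Q − 2Q'(P'Q − PQ')]·f + (P'Q − PQ')·Q·(12X² − A) = α²(12P²Q − A·Q³)`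
  (i.e. `R''f + R'f'/2 = α²(6R² − A/2)`: `u'' = α²(6u² − A/2)`).

This file provides the **certificate checker**: a small computable model of `ℤ[w][X]`
(`w² = t·w − n`; pairs of integers `ZW`, coefficient lists `Poly`) with its denotation into
Mathlib's `ℂ[X]` (`ZW.toC`, `Poly.toPoly`), the Boolean test `check t n A B α P Q` of `(H1)`,
`(H2)` and `Q ≠ 0`, and its soundness `check_sound`: if `check … = true` and `w ∈ ℂ` satisfies
`w² = t w − n`, `Im w ≠ 0`, then the denoted polynomials satisfy `(H1)`, `(H2)` in `ℂ[X]` and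
`Q ≠ 0`.  The certificates themselves (degrees `2, 2, 3, 5, 11, 17, 41`) are checked by
`decide +kernel` in `SingularModuliCertificates.lean`.

Design notes.  Everything computable is structurally recursive on lists so that the kernel
evaluates it (the degree-`41` certificate for `d = −163`, with 128-digit coefficients, checks in
under a minute).  Mathlib's `Polynomial` is not computable, whence the reflection layer; the
denotation lemmas (`toPoly_addP`, `toPoly_mulP`, `toPoly_derivP`, …) are the only interface used
downstream.  No `native_decide` (axiom `Lean.ofReduceBool`) is involved.

## References

* H. Weber, *Lehrbuch der Algebra*, Bd. III (Elliptische Funktionen und algebraische Zahlen),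
  2. Aufl., Vieweg 1908, §§ 114–115 (complex multiplication of `℘`, transformation equations).
* J. H. Silverman, *Advanced Topics in the Arithmetic of Elliptic Curves*, GTM 151, Springer
  1994, Prop. II.1.1, §II.2 (CM curves over `ℂ`, `[α]^*ω = αω`), App. A §3 (the class number one
  `j`-invariants).
* D. A. Cox, *Primes of the form x² + ny²*, 2nd ed., Wiley 2013, §10.C–D, §12.C table (12.20).
-/

namespace Literature.NumberTheory.EllipticCurves.CMCert

open Polynomial

/-! ### The ring `ℤ[w]`, `w² = t w − n`, as pairs of integers -/

/-- An element `a + b·w` of the order `ℤ[w]` (`w² = t·w − n`), stored as the pair `(a, b)`;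
the multiplication depends on the parameters `t, n` (`ZW.mul`).  For the class-number-one
discriminants: `w = (1 + √d)/2`, `t = 1`, `n = (1 − d)/4` (`d` odd) and `w = √−2`, `t = 0`,
`n = 2` (`d = −8`). [folklore] -/
structure ZW where
  /-- rational part `a` of `a + b·w` -/
  a : ℤ
  /-- `w`-part `b` of `a + b·w` -/
  b : ℤ
deriving DecidableEq

namespace ZW

/-- `0 ∈ ℤ[w]`. [folklore] -/
def zero : ZW := ⟨0, 0⟩

/-- The integer `k` as an element of `ℤ[w]`. [folklore] -/
def ofInt (k : ℤ) : ZW := ⟨k, 0⟩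

/-- Addition in `ℤ[w]`. [folklore] -/
def add (x y : ZW) : ZW := ⟨x.a + y.a, x.b + y.b⟩

/-- Negation in `ℤ[w]`. [folklore] -/
def neg (x : ZW) : ZW := ⟨-x.a, -x.b⟩

/-- Multiplication in `ℤ[w]` with `w² = t·w − n`:
`(a + bw)(a' + b'w) = (aa' − n bb') + (ab' + ba' + t bb') w`. [folklore] -/
def mul (t n : ℤ) (x y : ZW) : ZW :=
  ⟨x.a * y.a - n * (x.b * y.b), x.a * y.b + x.b * y.a + t * (x.b * y.b)⟩

/-- Denotation `a + b·w ∈ ℂ` of `(a, b)` at a complex number `w`. [folklore] -/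
def toC (w : ℂ) (x : ZW) : ℂ := (x.a : ℂ) + (x.b : ℂ) * w

/-- `toC` on a pair. [folklore] -/
@[simp] lemma toC_mk (w : ℂ) (a b : ℤ) : toC w ⟨a, b⟩ = (a : ℂ) + (b : ℂ) * w := rfl

/-- `toC 0 = 0`. [folklore] -/
@[simp] lemma toC_zero (w : ℂ) : toC w zero = 0 := by simp [zero, toC]

/-- `toC k = k`. [folklore] -/
@[simp] lemma toC_ofInt (w : ℂ) (k : ℤ) : toC w (ofInt k) = k := by simp [ofInt, toC]

/-- `toC` is additive. [folklore] -/
@[simp] lemma toC_add (w : ℂ) (x y : ZW) : toC w (add x y) = toC w x + toC w y := by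
  simp only [add, toC]; push_cast; ring

/-- `toC (−x) = −toC x`. [folklore] -/
@[simp] lemma toC_neg (w : ℂ) (x : ZW) : toC w (neg x) = -toC w x := by
  simp only [neg, toC]; push_cast; ring

/-- `toC` is multiplicative at any `w` with `w² = t w − n`. [folklore] -/
lemma toC_mul {t n : ℤ} {w : ℂ} (hw : w ^ 2 = t * w - n) (x y : ZW) :
    toC w (mul t n x y) = toC w x * toC w y := by
  simp only [mul, toC]; push_cast; linear_combination (-(x.b : ℂ) * y.b) * hw

/-- `a + b w = 0` with `Im w ≠ 0` forces `a = b = 0`. [folklore] -/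
lemma eq_zero_of_toC_eq_zero {w : ℂ} (hw : w.im ≠ 0) {x : ZW} (h : toC w x = 0) : x = zero := by
  have him := congrArg Complex.im h
  have hre := congrArg Complex.re h
  simp only [toC, Complex.add_im, Complex.intCast_im, Complex.mul_im, Complex.intCast_re,
    zero_mul, add_zero, zero_add, Complex.zero_im, mul_eq_zero, Int.cast_eq_zero] at him
  have hb : x.b = 0 := him.resolve_right hw
  simp only [toC, hb, Int.cast_zero, zero_mul, add_zero, Complex.intCast_re, Complex.zero_re,
    Int.cast_eq_zero] at hre
  cases x
  simp only [zero, mk.injEq]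
  exact ⟨hre, hb⟩

end ZW

/-! ### Coefficient lists -/

/-- Polynomials over `ℤ[w]` as coefficient lists, constant term first. [folklore] -/
abbrev Poly := List ZW

namespace Poly

/-- Sum of coefficient lists. [folklore] -/
def addP : Poly → Poly → Poly
  | [], q => q
  | a :: p, [] => a :: p
  | a :: p, b :: q => ZW.add a b :: addP p q

/-- Negation of a coefficient list. [folklore] -/
def negP (p : Poly) : Poly := p.map ZW.neg

/-- Difference of coefficient lists. [folklore] -/
def subP (p q : Poly) : Poly := addP p (negP q)

/-- Scalar multiple `c · p`. [folklore] -/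
def smulP (t n : ℤ) (c : ZW) (p : Poly) : Poly := p.map (ZW.mul t n c)

/-- Product of coefficient lists (`(a + X p) q = a q + X (p q)`). [folklore] -/
def mulP (t n : ℤ) : Poly → Poly → Poly
  | [], _ => []
  | a :: p, q => addP (smulP t n a q) (ZW.zero :: mulP t n p q)

/-- `derivAux k [c₀, c₁, …] = [k c₀, (k+1) c₁, …]`. [folklore] -/
def derivAux (t n : ℤ) : ℤ → Poly → Poly
  | _, [] => []
  | k, c :: cs => ZW.mul t n (ZW.ofInt k) c :: derivAux t n (k + 1) cs

/-- Formal derivative of a coefficient list. [folklore] -/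
def derivP (t n : ℤ) : Poly → Poly
  | [] => []
  | _ :: cs => derivAux t n 1 cs

/-- All coefficients vanish. [folklore] -/
def isZeroP (p : Poly) : Bool := p.all fun c => decide (c = ZW.zero)

/-- Equality of coefficient lists up to trailing zeros. [folklore] -/
def eqvP : Poly → Poly → Bool
  | [], q => isZeroP q
  | a :: p, [] => isZeroP (a :: p)
  | a :: p, b :: q => decide (a = b) && eqvP p q

/-- Denotation of a coefficient list as a polynomial over `ℂ` (at `w ∈ ℂ`). [folklore] -/
noncomputable def toPoly (w : ℂ) : Poly → ℂ[X]
  | [] => 0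
  | c :: p => C (c.toC w) + X * toPoly w p

variable {t n : ℤ} {w : ℂ}

/-- The empty list denotes `0`. [folklore] -/
@[simp] lemma toPoly_nil : toPoly w [] = 0 := rfl

/-- `toPoly (c :: p) = c + X · toPoly p`. [folklore] -/
@[simp] lemma toPoly_cons (c : ZW) (p : Poly) :
    toPoly w (c :: p) = C (c.toC w) + X * toPoly w p := rfl

/-- `toPoly` is additive. [folklore] -/
lemma toPoly_addP (p q : Poly) : toPoly w (addP p q) = toPoly w p + toPoly w q := by
  induction p generalizing q with
  | nil => simp [addP]
  | cons a p ih =>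
    cases q with
    | nil => simp [addP]
    | cons b q => simp only [addP, toPoly_cons, ZW.toC_add, map_add, ih]; ring

/-- `toPoly (−p) = −toPoly p`. [folklore] -/
lemma toPoly_negP (p : Poly) : toPoly w (negP p) = -toPoly w p := by
  induction p with
  | nil => simp [negP]
  | cons a p ih =>
    simp only [negP, List.map_cons, toPoly_cons, ZW.toC_neg, map_neg] at ih ⊢
    rw [ih]; ring

/-- `toPoly` respects subtraction. [folklore] -/
lemma toPoly_subP (p q : Poly) : toPoly w (subP p q) = toPoly w p - toPoly w q := by
  rw [subP, toPoly_addP, toPoly_negP, sub_eq_add_neg]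

/-- `toPoly (c · p) = c · toPoly p` (`w² = t w − n`). [folklore] -/
lemma toPoly_smulP (hw : w ^ 2 = t * w - n) (c : ZW) (p : Poly) :
    toPoly w (smulP t n c p) = C (c.toC w) * toPoly w p := by
  induction p with
  | nil => simp [smulP]
  | cons a p ih =>
    simp only [smulP, List.map_cons, toPoly_cons, ZW.toC_mul hw, map_mul] at ih ⊢
    rw [ih]; ring

/-- `toPoly` is multiplicative (`w² = t w − n`). [folklore] -/
lemma toPoly_mulP (hw : w ^ 2 = t * w - n) (p q : Poly) :
    toPoly w (mulP t n p q) = toPoly w p * toPoly w q := by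
  induction p with
  | nil => simp [mulP]
  | cons a p ih =>
    simp only [mulP, toPoly_addP, toPoly_smulP hw, toPoly_cons, ZW.toC_zero, map_zero,
      zero_add, ih]
    ring

/-- `toPoly (derivAux k p) = k · toPoly p + X · (toPoly p)'`. [folklore] -/
lemma toPoly_derivAux (hw : w ^ 2 = t * w - n) (k : ℤ) (p : Poly) :
    toPoly w (derivAux t n k p) = C (k : ℂ) * toPoly w p + X * derivative (toPoly w p) := by
  induction p generalizing k with
  | nil => simp [derivAux]
  | cons c p ih =>
    simp only [derivAux, toPoly_cons, ZW.toC_mul hw, ZW.toC_ofInt, ih, derivative_add,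
      derivative_C, derivative_mul, derivative_X, one_mul, zero_add, map_mul]
    push_cast
    simp only [map_add, map_one]
    ring

/-- `toPoly` commutes with the formal derivative (`w² = t w − n`). [folklore] -/
lemma toPoly_derivP (hw : w ^ 2 = t * w - n) (p : Poly) :
    toPoly w (derivP t n p) = derivative (toPoly w p) := by
  cases p with
  | nil => simp [derivP]
  | cons c p =>
    simp only [derivP, toPoly_derivAux hw, toPoly_cons, derivative_add, derivative_C,
      derivative_mul, derivative_X, one_mul, zero_add, Int.cast_one, map_one]

/-- A list of zero coefficients denotes `0`. [folklore] -/
lemma toPoly_eq_zero_of_isZeroP {p : Poly} (h : isZeroP p = true) : toPoly w p = 0 := by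
  induction p with
  | nil => rfl
  | cons c p ih =>
    simp only [isZeroP, List.all_cons, Bool.and_eq_true, decide_eq_true_eq] at h
    simp only [isZeroP] at ih
    rw [toPoly_cons, h.1, ih h.2, ZW.toC_zero, map_zero, mul_zero, add_zero]

/-- Equivalent lists denote equal polynomials. [folklore] -/
lemma toPoly_eq_of_eqvP {p q : Poly} (h : eqvP p q = true) : toPoly w p = toPoly w q := by
  induction p generalizing q with
  | nil => exact (toPoly_eq_zero_of_isZeroP (by simpa [eqvP] using h)).symm
  | cons a p ih =>
    cases q with
    | nil => exact toPoly_eq_zero_of_isZeroP (by simpa [eqvP] using h)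
    | cons b q =>
      simp only [eqvP, Bool.and_eq_true, decide_eq_true_eq] at h
      rw [toPoly_cons, toPoly_cons, h.1, ih h.2]

/-- A list denoting `0` at `w` with `Im w ≠ 0` consists of zeros. [folklore] -/
lemma isZeroP_of_toPoly_eq_zero (hw : w.im ≠ 0) {p : Poly} (h : toPoly w p = 0) :
    isZeroP p = true := by
  induction p with
  | nil => rfl
  | cons c p ih =>
    rw [toPoly_cons] at h
    have h0 : C (c.toC w) = 0 ∧ toPoly w p = 0 := by
      have hc := congrArg (fun q => q.coeff 0) h
      simp only [coeff_add, coeff_C_zero, coeff_X_mul_zero, add_zero, coeff_zero] at hc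
      refine ⟨by rw [hc, map_zero], ?_⟩
      have h' : X * toPoly w p = 0 := by rw [hc, map_zero, zero_add] at h; exact h
      exact (mul_eq_zero.mp h').resolve_left X_ne_zero
    have hc0 : c = ZW.zero := ZW.eq_zero_of_toC_eq_zero hw (C_eq_zero.mp h0.1)
    simp only [isZeroP, List.all_cons, Bool.and_eq_true, decide_eq_true_eq]
    exact ⟨hc0, by simpa [isZeroP] using ih h0.2⟩

end Poly

/-! ### The certificate checker and its soundness -/

open CMCert.Poly ZW

/-- **The certificate test.**  For parameters `t, n` (`w² = t w − n`), integers `A, B`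
(`g₂, g₃`), `α ∈ ℤ[w]` and coefficient lists `P, Q`, `check t n A B α P Q` computes both sides
of the identities `(H1)` `f·(P'Q − PQ')² = α²·(4P³ − A·P·Q² − B·Q³)·Q` and `(H2)`
`2[(P''Q − PQ'')Q − 2Q'(P'Q − PQ')]·f + (P'Q − PQ')·Q·(12X² − A) = α²·(12P²Q − A·Q³)`
(`f = 4X³ − AX − B`) in `ℤ[w][X]` and tests them, together with `Q ≠ 0`.  These say that
`R = P/Q` satisfies `f R'² = α² f(R)` and `R''f + R'f'/2 = α²(6R² − A/2)`, i.e. that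
`u = R(℘_Λ)` solves the Weierstrass equations of `Λ` (`g₂ = A`, `g₃ = B`) rescaled by `α` — the
differential characterisation of the complex multiplication `℘(αz) = R(℘(z))` (Weber,
*Algebra* III, §§ 114–115). [folklore] -/
def check (t n A B : ℤ) (α : ZW) (P Q : Poly) : Bool :=
  let f : Poly := [ofInt (-B), ofInt (-A), ZW.zero, ofInt 4]
  let f' : Poly := [ofInt (-A), ZW.zero, ofInt 12]
  let P' := derivP t n P
  let Q' := derivP t n Q
  let P'' := derivP t n P'
  let Q'' := derivP t n Q'
  let D := subP (mulP t n P' Q) (mulP t n P Q')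
  let α2 := ZW.mul t n α α
  let lhs1 := mulP t n f (mulP t n D D)
  let N := subP (subP (smulP t n (ofInt 4) (mulP t n P (mulP t n P P)))
      (smulP t n (ofInt A) (mulP t n P (mulP t n Q Q))))
      (smulP t n (ofInt B) (mulP t n Q (mulP t n Q Q)))
  let rhs1 := smulP t n α2 (mulP t n N Q)
  let lhs2 := addP (smulP t n (ofInt 2)
      (mulP t n (subP (mulP t n (subP (mulP t n P'' Q) (mulP t n P Q'')) Q)
        (smulP t n (ofInt 2) (mulP t n Q' D))) f))
      (mulP t n (mulP t n D Q) f')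
  let rhs2 := smulP t n α2 (subP (smulP t n (ofInt 12) (mulP t n (mulP t n P P) Q))
      (smulP t n (ofInt A) (mulP t n Q (mulP t n Q Q))))
  !(isZeroP Q) && (eqvP lhs1 rhs1 && eqvP lhs2 rhs2)

/-- The hypotheses certified by `check`, for polynomials `P, Q ∈ ℂ[X]`, invariants `g₂, g₃` and
multiplier `α`: `Q ≠ 0`, `(H1)` `f·(P'Q − PQ')² = α²·(4P³ − g₂PQ² − g₃Q³)·Q` and `(H2)`
`2[(P''Q − PQ'')Q − 2Q'(P'Q − PQ')]·f + (P'Q − PQ')Q(12X² − g₂) = α²(12P²Q − g₂Q³)`, where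
`f = 4X³ − g₂X − g₃` (`u = (P/Q)(℘)` satisfies `u'² = α²f(u)` and `u'' = α²(6u² − g₂/2)`).
[folklore] -/
def IsCMCertificate (g₂ g₃ α : ℂ) (P Q : ℂ[X]) : Prop :=
  Q ≠ 0 ∧
  (C 4 * X ^ 3 - C g₂ * X - C g₃) * (derivative P * Q - P * derivative Q) ^ 2 =
    C (α ^ 2) * ((C 4 * P ^ 3 - C g₂ * P * Q ^ 2 - C g₃ * Q ^ 3) * Q) ∧
  C 2 * ((((derivative (derivative P)) * Q - P * derivative (derivative Q)) * Q -
      C 2 * (derivative Q * (derivative P * Q - P * derivative Q))) *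
      (C 4 * X ^ 3 - C g₂ * X - C g₃)) +
    (derivative P * Q - P * derivative Q) * Q * (C 12 * X ^ 2 - C g₂) =
    C (α ^ 2) * (C 12 * P ^ 2 * Q - C g₂ * Q ^ 3)

/-- **Soundness of the certificate checker.**  If `check t n A B α P Q = true` and `w ∈ ℂ ∖ ℝ`
satisfies `w² = t w − n`, then the complex polynomials denoted by `P, Q` at `w` satisfy `Q ≠ 0`,
`(H1)` and `(H2)` with `g₂ = A`, `g₃ = B` and multiplier `α(w)` (`IsCMCertificate`).
[folklore] -/
theorem check_sound {t n A B : ℤ} {α : ZW} {P Q : Poly} {w : ℂ} (hw : w ^ 2 = t * w - n)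
    (hw' : w.im ≠ 0) (h : check t n A B α P Q = true) :
    IsCMCertificate (A : ℂ) (B : ℂ) (α.toC w) (toPoly w P) (toPoly w Q) := by
  simp only [check, Bool.and_eq_true, Bool.not_eq_true'] at h
  obtain ⟨hQ, h1, h2⟩ := h
  have hf : toPoly w [ofInt (-B), ofInt (-A), ZW.zero, ofInt 4] =
      C 4 * X ^ 3 - C (A : ℂ) * X - C (B : ℂ) := by
    simp only [toPoly_cons, toPoly_nil, toC_ofInt, toC_zero, Int.cast_neg, Int.cast_ofNat, map_neg,
      map_zero]
    ring
  have hf' : toPoly w [ofInt (-A), ZW.zero, ofInt 12] = C 12 * X ^ 2 - C (A : ℂ) := by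
    simp only [toPoly_cons, toPoly_nil, toC_ofInt, toC_zero, Int.cast_neg, Int.cast_ofNat, map_neg,
      map_zero]
    ring
  refine ⟨fun h0 => ?_, ?_, ?_⟩
  · rw [isZeroP_of_toPoly_eq_zero hw' h0] at hQ
    exact Bool.noConfusion hQ
  · have e := toPoly_eq_of_eqvP (w := w) h1
    simp only [toPoly_mulP hw, toPoly_subP, toPoly_smulP hw, toPoly_derivP hw, hf,
      toC_mul hw, toC_ofInt] at e
    simp only [map_ofNat, map_intCast, map_pow, map_mul, Int.cast_ofNat] at e ⊢
    linear_combination e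
  · have e := toPoly_eq_of_eqvP (w := w) h2
    simp only [toPoly_mulP hw, toPoly_addP, toPoly_subP, toPoly_smulP hw, toPoly_derivP hw, hf,
      hf', toC_mul hw, toC_ofInt] at e
    simp only [map_ofNat, map_intCast, map_pow, map_mul, Int.cast_ofNat] at e ⊢
    linear_combination e

end Literature.NumberTheory.EllipticCurves.CMCert
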